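import Summits.RiemannHypothesis.RiemannHypothesis.Theorems.TiltedLandingLaw421R3JensenDipQuantW
import Summits.RiemannHypothesis.RiemannHypothesis.Theorems.TiltedLandingLaw421R3Lens1CoverageD

/-!
# lens-1 (rh33346) — module W, part B: coverage glue for the weighted quantitative Jensen dip

Ideation workfile; nothing here bears on the truth of RH; RH is not proved; 33346/33347 OPEN.  Cell datum `LandingDipW` (data `h, Bw, Rm`;
`⊇ LandingDipQ`), PROVED `regime_LW` (:= `RhW08.Lens1Quant.succ_of_dip_edgeWR`), weaker residual stub `RegLfarW8`, and the v5 composition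
`TiltedLandingLaw421R_of_regimes5 : RegCov8 → RegLfarW8 → RegEres8 → RateLawsHalfQ → crux`.  Part A = `…R3JensenDipQuantW` (§W1–W2).
-/

set_option linter.unusedVariables false
set_option linter.unusedSectionVars false

noncomputable section

open Complex Set Filter Metric Topology
open scoped ComplexConjugate
open Literature.Analysis.Complex
open Summit.RiemannHypothesis.RiemannHypothesis.Theorems.Splittings.JensenWindow
open RhIdea6.G17.W07C7 RhIdea6.G17.W07C7.Rev6 RhIdea6.G18.W07C8.Law421BirthS RhIdea6.G19.W07C11.Seam
open RhIdea6.G20.W07C12.Frac RhIdea6.G20.W07C12.StColP RhW07.C12.FieldSplit RhIdea6.G21.W07C13.TentMax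
open RhW07.C14.TwoSided RhW07.C14.Classes RhW07.C14.Lineage RhW07.C14.Booking
open RhW07.C13.Heredity RhIdea6.G22.W07C15pre.Injection RhW07.E3.Cell RhW07.E3.Lit
open RhW08.Round1 RhW08.StSwap RhW08.Round2 RhW08.QuadW RhW08.SealSwapQ RhW08.SealSwap RhW08.SuccB RhW08.SuccSplit
open RhW08.SuccTheft RhW08.Column RhW08.Hurwitz RhW08.ClusterQ RhW08.ClusterQM RhW08.NewtonDoor RhW08.NewtonDoorGenusOne RhW08.PurseP
open RhW08.AntiEscapeSplit7

namespace RhW08.Lens1Coverage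

/-! ## §W3 The weighted landing cell «L-W» -/

/-- WEIGHTED CONE BUDGET ABOVE HEIGHT `h` of `g := f^{(j+1)}` over the real point `xs` (= the hypothesis `hB` of
`RhW08.Lens1Quant.succ_of_dip_edgeW`): every list of zeros of `g` in the open Jensen cone `|xs − Re a| < |Im a|` with `h ≤ |Im a|`
whose linear factors jointly divide `g` has `Σ 1/(Im a)² ≤ Bw`.  Instrument value: `Σ_{cone zeros a, |Im a| ≥ h} 1/(Im a)²`. -/
def ConeWeightAbove (f : ℂ → ℂ) (j : ℕ) (xs h Bw : ℝ) : Prop :=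
  ∀ L : List ℂ, (∀ a ∈ L, iteratedDeriv (j + 1) f a = 0 ∧ |xs - a.re| < |a.im| ∧ h ≤ |a.im|) →
    (∃ q : ℂ → ℂ, Differentiable ℂ q ∧ ∀ z, iteratedDeriv (j + 1) f z = (L.map (fun a => z - a)).prod * q z) →
      (L.map (fun a => 1 / a.im ^ 2)).sum ≤ Bw

/-- REMOVED-ZERO LIST of `g := f^{(j+1)}`: the linear factors of `Rm` jointly divide `g` (zeros with multiplicity; any sublist of the
zero multiset qualifies).  Instrument value: the tracked REAL zeros of `g` near `xs` and the lateral pairs outside the cone. -/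
def RemovedZeros (f : ℂ → ℂ) (j : ℕ) (Rm : List ℂ) : Prop :=
  ∃ q : ℂ → ℂ, Differentiable ℂ q ∧ ∀ z, iteratedDeriv (j + 1) f z = (Rm.map (fun b => z - b)).prod * q z

/-- TOTAL CHARGE of a removed list at the real point `xs`: `Σ_{b ∈ Rm} Re(1/(xs − b)²)` (a real zero `r` gives `1/(xs − r)²`; a conjugate
pair outside the closed Jensen cone gives `2(s² − t²)/(s² + t²)² ≥ 0`, `s = xs − Re b`, `t = Im b`). -/
def removedCharge (xs : ℝ) (Rm : List ℂ) : ℝ :=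
  (Rm.map (fun b => ((1 : ℂ) / ((xs : ℂ) - b) ^ 2).re)).sum

/-- CELL DATUM «L-W» (weighted quantitative landing dip under `v`, with far-field budget): the `LandingDip` jets at a real `xs` with
`|xs − Re v| < 2·Im v`, a height `h > 0` inside the LATERAL level-`(j+1)` window, a weighted cone budget `Bw` above `h`, and a removed
list `Rm` with `Bw·|m| < 2·|A| + |m|·removedCharge xs Rm`.  (`Rm = []`, `Bw = N/h²` is `LandingDipQ`: `landingDipW_of_Q`.) -/
def LandingDipW (f : ℂ → ℂ) (x₀ R Hs : ℝ) (j : ℕ) (v : ℂ) : Prop :=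
  ∃ xs m A : ℝ, |xs - v.re| < 2 * v.im ∧ (m : ℂ) = iteratedDeriv (j + 1) f xs ∧ iteratedDeriv (j + 2) f xs = 0 ∧
    ((2 * A : ℝ) : ℂ) = iteratedDeriv (j + 3) f xs ∧ 0 < m * A ∧
    ∃ (h Bw : ℝ) (Rm : List ℂ), 0 < h ∧ ConeWeightAbove f j xs h Bw ∧ RemovedZeros f j Rm ∧
      Bw * |m| < 2 * |A| + |m| * removedCharge xs Rm ∧
      (max (|xs - x₀| + h - R / 2) 0) ^ 2 + ((j : ℝ) + 1) * h ^ 2 ≤ ((j : ℝ) + 1) * Hs ^ 2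

/-- A weighted quantitative landing dip is a landing dip (drop the budget/height data). -/
theorem landingDip_of_W {f : ℂ → ℂ} {x₀ R Hs : ℝ} {j : ℕ} {v : ℂ} (h : LandingDipW f x₀ R Hs j v) : LandingDip f j v := by
  obtain ⟨xs, m, A, h1, h2, h3, h4, h5, -⟩ := h
  exact ⟨xs, m, A, h1, h2, h3, h4, h5⟩

/-- `L-Q ⊆ L-W`: a count budget `N` with floor `h` is a weight budget `Bw = N/h²` (and no zero need be removed). -/
theorem landingDipW_of_Q {f : ℂ → ℂ} (hf : Differentiable ℂ f) {x₀ R Hs : ℝ} {j : ℕ} {v : ℂ} (h : LandingDipQ f x₀ R Hs j v) :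
    LandingDipW f x₀ R Hs j v := by
  obtain ⟨xs, m, A, h1, hm, h2, hA, hmA, N, h, hN, hh, hNh, hwin⟩ := h
  have hh2 : 0 < h ^ 2 := by positivity
  refine ⟨xs, m, A, h1, hm, h2, hA, hmA, h, (N : ℝ) / h ^ 2, [], hh, ?_,
    ⟨iteratedDeriv (j + 1) f, differentiable_iteratedDeriv_of_entire hf (j + 1), fun z => by simp⟩, ?_, hwin⟩
  · intro L hL hq
    have hlen : L.length ≤ N := hN L (fun a ha => ⟨(hL a ha).1, (hL a ha).2.1⟩) hq
    have hterm : ∀ y ∈ L.map (fun a => 1 / a.im ^ 2), y ≤ 1 / h ^ 2 := by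
      intro y hy
      obtain ⟨a, ha, rfl⟩ := List.mem_map.1 hy
      have hfl : h ≤ |a.im| := (hL a ha).2.2
      have hsq : h ^ 2 ≤ a.im ^ 2 := by
        rw [← sq_abs a.im]; exact pow_le_pow_left₀ hh.le hfl 2
      exact one_div_le_one_div_of_le hh2 hsq
    have hcard := List.sum_le_card_nsmul (L.map (fun a => 1 / a.im ^ 2)) (1 / h ^ 2) hterm
    rw [List.length_map, nsmul_eq_mul] at hcard
    have hlenR : (L.length : ℝ) ≤ N := by exact_mod_cast hlen
    calc (L.map (fun a => 1 / a.im ^ 2)).sum ≤ (L.length : ℝ) * (1 / h ^ 2) := hcard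
      _ ≤ (N : ℝ) * (1 / h ^ 2) := mul_le_mul_of_nonneg_right hlenR (by positivity)
      _ = (N : ℝ) / h ^ 2 := mul_one_div _ _
  · have e0 : removedCharge xs [] = 0 := by simp [removedCharge]
    rw [e0, mul_zero, add_zero, div_mul_eq_mul_div, div_lt_iff₀ hh2]
    exact hNh

/-- ★ REGIME LEMMA «L-W» (PROVED, successor currency): frame + a weighted quantitative landing dip ⇒ a successor at level `j+1`
(`RhW08.Lens1Quant.succ_of_dip_edgeWR`). -/
theorem regime_LW {η : ℝ} {f : ℂ → ℂ} {x₀ s hmax R Hs : ℝ} {B j : ℕ} {v : ℂ}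
    (hE : EngineHyps5 2 η f x₀ s hmax R Hs B) (h : LandingDipW f x₀ R Hs j v) :
    ∃ u : ℂ, StTrkDQ η f x₀ s hmax R Hs B (j + 1) u := by
  obtain ⟨xs, m, A, -, hm, h2, hA, hmA, h, Bw, Rm, hh, hB, hRm, hBm, hwin⟩ := h
  exact RhW08.Lens1Quant.succ_of_dip_edgeWR hE hm h2 hA hmA hh hB Rm hRm hBm hwin

/-! ## §W4 The residual stub «L-farW» and the v5 compositions -/

/-- (v5) OPEN REGIME «L-farW» in Q8-door currency: cell L with NEITHER a deep dip NOR a weighted quantitative dip ⇒ a door.  Strictly weaker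
than `RegLfar8` (`regLfarW8_of_regLfar8`); critic g24's corner inhabitant of the L-far cell is NOT in this cell. -/
def RegLfarW8 : Prop :=
  ∀ (η : ℝ) (f : ℂ → ℂ) (x₀ s hmax R Hs : ℝ) (B : ℕ), EngineHyps5 2 η f x₀ s hmax R Hs B → ∀ (j : ℕ) (v : ℂ),
    IsLowest StTrkDQ η f x₀ s hmax R Hs B j v → ¬ ReadyR2 η f x₀ s hmax R Hs B j v →
    ¬ AllInBandInRangeWindow f x₀ R Hs j v → ¬ Dimple f j v → DiscOverlap f j v →
    iteratedDeriv (j + 1) f v ≠ 0 → CellL f x₀ R Hs j v → ¬ LandingDipDeep f x₀ R Hs j v → ¬ LandingDipW f x₀ R Hs j v →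
    Doors8 f x₀ R Hs j v

/-- Monotonicity: the L-far stub implies the L-farW stub. -/
theorem regLfarW8_of_regLfar8 (hL : RegLfar8) : RegLfarW8 :=
  fun η f x₀ s hmax R Hs B hE j v hlow hnR hwin hdim hov hz hc hnd hnw =>
    hL η f x₀ s hmax R Hs B hE j v hlow hnR hwin hdim hov hz hc hnd (fun hq => hnw (landingDipW_of_Q hE.1 hq))

/-- Monotonicity: the SUCC law of record implies the residual stub. -/
theorem regLfarW8_of_doorAvailLawQ8 (hL8 : RhW08.LandingDoor.DoorAvailLawQ8) : RegLfarW8 :=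
  regLfarW8_of_regLfar8 (regLfar8_of_doorAvailLawQ8 hL8)

/-- ★ (v5) `AntiEscapeCore` from `RegCov8`, `RegLfarW8`, `RegEres8`: cells F, N♭, L-deep, L-W (⊇ L-Q), E-iso are discharged by PROVED
regime lemmas. -/
theorem antiEscapeCore_of_regimes5 (hRB : RealCritBoundNSig) (hC : RegCov8) (hL : RegLfarW8) (hX : RegEres8) : AntiEscapeCore := by
  intro η f x₀ s hmax R Hs B hE j v hlow hnR hwin hdim hov
  by_cases hz : iteratedDeriv (j + 1) f v = 0
  · exact succ_of_multiple hE hlow.1 hz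
  rcases cells_cover f x₀ R Hs j v with h | h | h | h | h
  · exact succ_of_doors8 hRB hE hlow hnR
      (hC η f x₀ s hmax R Hs B hE j v hlow hnR hwin hdim hov hz h (exists_cover_of_coverIndex_pos_frame hE hlow.1 hz h))
  · exact regime_F hE hlow.1 h
  · exact regime_Nb hE hlow.1 h
  · by_cases hdeep : LandingDipDeep f x₀ R Hs j v
    · exact regime_Ldeep hE hdeep
    · by_cases hw : LandingDipW f x₀ R Hs j v
      · exact regime_LW hE hw
      · exact succ_of_doors8 hRB hE hlow hnR (hL η f x₀ s hmax R Hs B hE j v hlow hnR hwin hdim hov hz h hdeep hw)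
  · by_cases hiso : IsolatedNewton f x₀ R j v
    · exact regime_Eiso hE hlow.1 hz hiso
    · exact succ_of_doors8 hRB hE hlow hnR (hX η f x₀ s hmax R Hs B hE j v hlow hnR hwin hdim hov hz h hiso)

/-- `RestSuccBotQ` from `RegCov8`, `RegLfarW8`, `RegEres8`, via `antiEscapeCore_of_regimes5`. -/
theorem restSuccBotQ_of_regimes5 (hRB : RealCritBoundNSig) (hC : RegCov8) (hL : RegLfarW8) (hX : RegEres8) : RestSuccBotQ :=
  restSuccBotQ_of_pieces dimpleSig_holds (antiEscape_of_core (antiEscapeCore_of_regimes5 hRB hC hL hX))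

/-- ★★ (v5) THE CRUX BY NAME from `RegCov8`, `RegLfarW8`, `RegEres8` and lens-2's rate law. -/
theorem TiltedLandingLaw421R_of_regimes5 (hC : RegCov8) (hL : RegLfarW8) (hX : RegEres8) (hR : RhW08.RateSplit.RateLawsHalfQ) :
    Summit.RiemannHypothesis.RiemannHypothesis.Theses.EarlyAppointments.TiltedLandingLaw421R :=
  law421Half_of_succ_rate (restSuccBotQ_of_regimes5 RhW08.ClusterQM.realCritBoundNSig_holds hC hL hX)
    (RhW08.RateSplit.restRateBotPQ_half_of_rateLaws hR)

/-- Sanity (v4 ⇒ v5): file D's hypotheses still close the crux through this file. -/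
theorem TiltedLandingLaw421R_of_regimes4' (hC : RegCov8) (hL : RegLfar8) (hX : RegEres8) (hR : RhW08.RateSplit.RateLawsHalfQ) :
    Summit.RiemannHypothesis.RiemannHypothesis.Theses.EarlyAppointments.TiltedLandingLaw421R :=
  TiltedLandingLaw421R_of_regimes5 hC (regLfarW8_of_regLfar8 hL) hX hR

end RhW08.Lens1Coverage

end
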